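import Summits.AtomisticToContinuum.Crystallization.Theorems.ThreeConeCertificateSlackRigidityPricedFloorsS3Defs
import Summits.AtomisticToContinuum.Crystallization.Theorems.PhononSlackCertificatesPeriodicGivenLayeredExtraction2
import Summits.AtomisticToContinuum.Crystallization.Theorems.ChessboardParticlePlanesPeriodicWindowsShapeStationarity1
import Literature.Probability.Process.RootedHardCoreConfig

/-!
# `SlackRigidity` (stmt-AtomisticToContinuum-11960), line `priced-floors-palm-exactification`:
# measurability of layer functionals of exactly layered samples (S3 measurability package)

Stub S3 (`stub_layeredMeanSelection`) integrates functionals of a rooted, globally exactly layered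
configuration that are defined through the normal-form layering data fitting it
(`…SlackRigidityPricedFloorsS3Defs`: `LData`, `IsNormalData`, `dataSet`, `Fits`, `dataSup`).  This
file proves the first two registered measurability sub-goals (the third, the transfer to
`Measure E3`, and the joint point-dependent version are in `…PricedFloorsMeasurability2`):

* `lms_isClosed_fits` — the fitting relation `{(S, e) | Fits ↑S e}` is CLOSED in (the compact metric
  space `LocalConfig.RootedHardCoreConfig E3 δ` of rooted `δ`-hard-core configurations with the
  local rubber metric) `×` `LData`.  Both factors are first countable, so sequential closedness
  suffices; along `(Sₙ, eₙ) → (S, e)`: normal data are closed (`isCompact_setOf_isNormalData`: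
  isometries `×` `[47/50, 1]` `×` `{±1}^ℤ` `×` boxes of heights, closed conditions); a pattern
  point of `e` is the limit of the same-index points of `eₙ ∈ ↑Sₙ` (`continuous_point`: the label
  of a fixed layer is locally constant in the word, `continuous_haggLabel`) and `↑Sₙ → ↑S` in the
  sense of local matchings (`LocalConfig.tendsto_iff_locallyMatches`), so it lies in the closed
  set `↑S`; conversely a point of `↑S` is matched by pattern points of `eₙ` of bounded norm, whose
  indices are uniformly bounded (`index_le`, via `ext_layer_bound` and lattice coordinates), and
  finitely many candidate limit points cannot all stay away from it.
* `lms_measurable_dataSup` — for continuous `φ : LData → ℝ`, `S ↦ dataSup φ ↑S` is Borel: the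
  super-level set `{c ≤ dataSup}` is `fst '' ({fits} ∩ {c ≤ φ}) ∪ ((fst '' {fits})ᶜ ∩ {c ≤ 0})`
  (the supremum over the compact fitting set is attained, and `dataSup = 0` when nothing fits),
  and projections of closed subsets of the fitting relation are closed (they live over the
  compact normal data; the configuration space is compact Hausdorff).

No definitions.  All `[folklore]`.
-/

noncomputable section

open MeasureTheory Filter Set Topology

namespace Summit.AtomisticToContinuum.Crystallization.Theorems.SlackRigidityPricedFloorsMeasurability

open Literature.Probability.Process
open Literature.MathematicalPhysics.StatisticalMechanics
open Summit.AtomisticToContinuum.Crystallization.Theorems.SlackRigidityPricedFloors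
open Summit.AtomisticToContinuum.Crystallization.Theorems.LayeredHull

/-! ## The data space: compactness of normal data, continuity of pattern points, index bounds -/

/-- **The normal-form data form a compact subset of `LData`**: closed conditions inside a product
of compact sets (`ext_isCompact_isometries`, `[47/50, 1]`, `ext_isCompact_words`, and a product
of intervals containing the heights by `ext_abs_height_le`).  (The same set as
`SlackRigidityPricedFloorsExactify.isCompact_data`; adapted from there.) [folklore] -/
theorem isCompact_setOf_isNormalData : IsCompact {e : LData | IsNormalData e} := by
  have ha : Continuous fun e : LData => e.2.1 := continuous_fst.comp continuous_snd
  have hs : ∀ i : ℤ, Continuous fun e : LData => e.2.2.1 i :=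
    fun i => (continuous_apply i).comp (continuous_fst.comp (continuous_snd.comp continuous_snd))
  have hz : ∀ m : ℤ, Continuous fun e : LData => e.2.2.2 m :=
    fun m => (continuous_apply m).comp (continuous_snd.comp (continuous_snd.comp continuous_snd))
  refine IsCompact.of_isClosed_subset (ext_isCompact_isometries.prod
    ((isCompact_Icc : IsCompact (Icc (47 / 50 : ℝ) 1)).prod (ext_isCompact_words.prod
      (isCompact_univ_pi fun m : ℤ => isCompact_closedBall (0 : ℝ) (((|m| : ℤ) : ℝ) + 1))))) ?_ ?_
  · simp only [IsNormalData, IsAdmissibleLayering, IsHaggSeq, setOf_and, setOf_forall]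
    refine (isClosed_iInter fun v => isClosed_eq ((continuous_eval_const v).comp
      continuous_fst).norm continuous_const).inter (((isClosed_le continuous_const ha).inter
      ((isClosed_le ha continuous_const).inter ((isClosed_iInter fun i => ?_).inter
      (isClosed_iInter fun m => (isClosed_le (by fun_prop) (by fun_prop)).inter
      (isClosed_le (by fun_prop) (by fun_prop)))))).inter (isClosed_eq (hz 0) continuous_const))
    exact (isClosed_discrete {y : ℤ | y = 1 ∨ y = -1}).preimage (hs i)
  · rintro ⟨T, a, s, z⟩ ⟨hT, ⟨ha0, ha1, hs', hz'⟩, hz0⟩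
    dsimp only at hT ha0 ha1 hs' hz' hz0
    refine mk_mem_prod hT (mk_mem_prod ⟨ha0, ha1⟩ (mk_mem_prod
      (mem_univ_pi.2 fun i => by rcases hs' i with h | h <;> simp [h]) (mem_univ_pi.2 fun m => ?_)))
    rw [mem_closedBall_zero_iff, Real.norm_eq_abs]
    have := ext_abs_height_le hz' ⟨by rw [hz0]; linarith, hz0.le⟩ m
    have h0 : (0 : ℝ) ≤ ((|m| : ℤ) : ℝ) := by exact_mod_cast abs_nonneg m
    nlinarith

/-- For a fixed layer `m`, the label `haggLabel s m` is a continuous (locally constant) function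
of the word `s` in the product topology: it only depends on `s` restricted to `|n| ≤ |m|`
(`ext_haggLabel_eq_of_eqOn`). [folklore] -/
theorem continuous_haggLabel (m : ℤ) : Continuous fun s : ℤ → ℤ => haggLabel s m := by
  refine continuous_iff_continuousAt.2 fun s₀ => ?_
  have hev : ∀ᶠ s in 𝓝 s₀, ∀ n ∈ Finset.Icc (-(m.natAbs : ℤ)) m.natAbs, s n = s₀ n :=
    (eventually_all_finset _).2 fun n _ =>
      ((continuous_apply n).tendsto s₀).eventually
        (show ∀ᶠ y in 𝓝 (s₀ n), y = s₀ n by simp [nhds_discrete])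
  refine (tendsto_pure.2 (hev.mono fun s hs => ?_)).mono_right (pure_le_nhds _)
  exact ext_haggLabel_eq_of_eqOn (M := m.natAbs)
    (fun n hn => hs n (Finset.mem_Icc.2 (abs_le.1 hn))) m (by simp)

/-- **The pattern point with fixed indices `(m, i, j)` depends continuously on the data**
(frame in operator norm, spacing, word and heights pointwise; the lattice vectors are `a • u(1)`,
`a • v(1)`, `a • w(1)`, cf. `SlackRigidityPricedFloorsExactify.continuous_vecs`; the label of layer
`m` is locally constant in the word, `continuous_haggLabel`). [folklore] -/
theorem continuous_point (m i j : ℤ) : Continuous fun e : LData =>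
    e.1 (((i : ℝ) • triangularVec₁ e.2.1) + ((j : ℝ) • triangularVec₂ e.2.1) +
      ((haggLabel e.2.2.1 m : ℝ) • barlowOffset e.2.1) + (e.2.2.2 m • layerNormal 1)) := by
  have hu : Continuous fun a : ℝ => (triangularVec₁ a : E3) := by
    rw [show (fun a : ℝ => (triangularVec₁ a : E3)) = fun a => a • triangularVec₁ 1 by
      funext a; ext k; fin_cases k <;> simp [triangularVec₁]]
    exact continuous_id.smul continuous_const
  have hv : Continuous fun a : ℝ => (triangularVec₂ a : E3) := by
    rw [show (fun a : ℝ => (triangularVec₂ a : E3)) = fun a => a • triangularVec₂ 1 by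
      funext a; ext k; fin_cases k <;> simp [triangularVec₂] <;> ring]
    exact continuous_id.smul continuous_const
  have hw : Continuous fun a : ℝ => (barlowOffset a : E3) := by
    rw [show (fun a : ℝ => (barlowOffset a : E3)) = fun a => a • barlowOffset 1 by
      funext a; ext k; fin_cases k <;> simp [barlowOffset] <;> ring]
    exact continuous_id.smul continuous_const
  have ha : Continuous fun e : LData => e.2.1 := continuous_fst.comp continuous_snd
  have hz : Continuous fun e : LData => e.2.2.2 m :=
    (continuous_apply m).comp (continuous_snd.comp (continuous_snd.comp continuous_snd))
  have hs : Continuous fun e : LData => e.2.2.1 :=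
    continuous_fst.comp (continuous_snd.comp continuous_snd)
  have hL : Continuous fun e : LData => ((haggLabel e.2.2.1 m : ℤ) : ℝ) :=
    (continuous_of_discreteTopology (f := (Int.cast : ℤ → ℝ))).comp
      ((continuous_haggLabel m).comp hs)
  exact continuous_fst.clm_apply (((((hu.comp ha).const_smul (i : ℝ)).add
    ((hv.comp ha).const_smul (j : ℝ))).add (hL.smul (hw.comp ha))).add
    (hz.smul continuous_const))

/-- **Uniform index bound.** For admissible data with `z 0 = 0` and an isometric frame, a
pattern point of norm `≤ N` has layer index and in-plane indices of size `≤ 4N + 3` (the height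
of the point is `z m`, `ext_layer_bound`; its first two coordinates are `a (i + j/2 + L/2)` and
`a √3 (j/2 + L/6)` with `|L| ≤ |m|`, `shp_abs_haggLabel_sub_le`). [folklore] -/
theorem index_le {a : ℝ} {s : ℤ → ℤ} {z : ℤ → ℝ} (hadm : IsAdmissibleLayering a s z)
    (hz0 : z 0 = 0) {T : E3 →L[ℝ] E3} (hT : ∀ v, ‖T v‖ = ‖v‖) {N : ℕ} {m i j : ℤ}
    (h : ‖T (((i : ℝ) • triangularVec₁ a) + ((j : ℝ) • triangularVec₂ a) +
      ((haggLabel s m : ℝ) • barlowOffset a) + (z m • layerNormal 1))‖ ≤ N) :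
    |m| ≤ ((4 * N + 3 : ℕ) : ℤ) ∧ |i| ≤ ((4 * N + 3 : ℕ) : ℤ) ∧ |j| ≤ ((4 * N + 3 : ℕ) : ℤ) := by
  obtain ⟨ha0, ha1, hs, hz⟩ := hadm
  rw [hT] at h
  set q : E3 := ((i : ℝ) • triangularVec₁ a) + ((j : ℝ) • triangularVec₂ a) +
      ((haggLabel s m : ℝ) • barlowOffset a) + (z m • layerNormal 1) with hq
  have hN : (0 : ℝ) ≤ N := N.cast_nonneg
  have hc : ∀ k, |q k| ≤ N := fun k =>
    le_trans (by rw [← Real.norm_eq_abs]; exact PiLp.norm_apply_le q k) h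
  have hq2 : q 2 = z m := by
    simp [hq, triangularVec₁, triangularVec₂, barlowOffset, layerNormal]
  have hq1 : q 1 = (a * √3) * ((j : ℝ) / 2 + (haggLabel s m : ℝ) / 6) := by
    simp [hq, triangularVec₁, triangularVec₂, barlowOffset, layerNormal]; ring
  have hq0 : q 0 = a * ((i : ℝ) + (j : ℝ) / 2 + (haggLabel s m : ℝ) / 2) := by
    simp [hq, triangularVec₁, triangularVec₂, barlowOffset, layerNormal]; ring
  have hm : |m| ≤ (2 * N + 3 : ℕ) := by
    refine ext_layer_bound (R := N) (M := 2 * N + 3) (by linarith) ha1 hz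
      ⟨by rw [hz0]; linarith, hz0.le⟩ ?_ ?_
    · have h1 : 47 / 50 * ((2 * N + 3 : ℕ) : ℝ) ≤ a * ((2 * N + 3 : ℕ) : ℝ) :=
        mul_le_mul_of_nonneg_right ha0 (by positivity)
      push_cast at h1 ⊢
      nlinarith
    · rw [← hq2]
      linarith [hc 2]
  have hL : |(haggLabel s m : ℝ)| ≤ 2 * N + 3 := by
    have h := (PeriodicWindowsSketch.shp_abs_haggLabel_sub_le hs 0 m).trans (by simpa using hm)
    have h' : |haggLabel s m| ≤ ((2 * N + 3 : ℕ) : ℤ) := by simpa using h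
    have h'' : (|haggLabel s m| : ℝ) ≤ (((2 * N + 3 : ℕ) : ℤ) : ℝ) := by exact_mod_cast h'
    push_cast at h''
    exact h''
  have h3 : (3 / 2 : ℝ) ≤ √3 := by
    nlinarith [Real.sq_sqrt (show (0 : ℝ) ≤ 3 by norm_num), Real.sqrt_nonneg 3]
  obtain ⟨hL1, hL2⟩ := abs_le.1 hL
  -- the in-plane index `j`
  have h1 := hc 1
  rw [hq1, abs_mul, abs_of_pos (by nlinarith)] at h1
  have hw : 141 / 100 * |(j : ℝ) / 2 + (haggLabel s m : ℝ) / 6| ≤ N :=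
    le_trans (mul_le_mul_of_nonneg_right (by nlinarith) (abs_nonneg _)) h1
  obtain ⟨hw1, hw2⟩ := abs_le.1
    (show |(j : ℝ) / 2 + (haggLabel s m : ℝ) / 6| ≤ 100 / 141 * N by linarith)
  have hjr1 : (j : ℝ) ≤ 21 / 10 * N + 1 := by linarith
  have hjr2 : -(21 / 10 * N + 1) ≤ (j : ℝ) := by linarith
  -- the in-plane index `i`
  have h0 := hc 0
  rw [hq0, abs_mul, abs_of_pos (by linarith : (0 : ℝ) < a)] at h0
  have hw' : 47 / 50 * |(i : ℝ) + (j : ℝ) / 2 + (haggLabel s m : ℝ) / 2| ≤ N :=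
    le_trans (mul_le_mul_of_nonneg_right ha0 (abs_nonneg _)) h0
  obtain ⟨hw1', hw2'⟩ := abs_le.1
    (show |(i : ℝ) + (j : ℝ) / 2 + (haggLabel s m : ℝ) / 2| ≤ 50 / 47 * N by linarith)
  have hi1 : i < 4 * N + 3 := by exact_mod_cast (by linarith : (i : ℝ) < 4 * N + 3)
  have hi2 : -(4 * (N : ℤ) + 3) < i := by exact_mod_cast (by linarith : -(4 * (N : ℝ) + 3) < i)
  have hj1 : j < 4 * N + 4 := by exact_mod_cast (by linarith : (j : ℝ) < 4 * N + 4)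
  have hj2 : -(4 * (N : ℤ) + 4) < j := by exact_mod_cast (by linarith : -(4 * (N : ℝ) + 4) < j)
  have hm' := abs_le.1 hm
  push_cast at hm'
  refine ⟨?_, ?_, ?_⟩ <;> · rw [abs_le]; push_cast; omega

/-! ## Sub-goal (1): the fitting relation is closed -/

/-- **Sub-goal `lms_isClosed_fits`.** The fitting relation `{(S, e) | e is normal-form data
presenting exactly ↑S}` is closed in (rooted `δ`-hard-core configurations, local rubber metric)
`×` (data space).  Both factors are first countable, so sequential closedness suffices: along
`(Sₙ, eₙ) → (S, e)` with `dataSet eₙ = ↑Sₙ`, the limit data are normal (closed condition); a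
pattern point of `e` is the limit of the same-index points of `eₙ` (`continuous_point`), which lie
in `↑Sₙ`, and `↑Sₙ → ↑S` locally, so it lies in the closed set `↑S`; conversely a point `q ∈ ↑S` is
matched by points of `dataSet eₙ` whose indices are uniformly bounded (`index_le`), and if `q` were
not a pattern point of `e` these finitely many candidate points would stay away from `q`.
[folklore] -/
theorem lms_isClosed_fits : ∀ (δ : ℝ) [Fact (0 < δ)], IsClosed {x : LocalConfig.RootedHardCoreConfig E3 δ × LData | Fits ((x.1.1 : LocalConfig E3) : Set E3) x.2} := by
  intro δ hδ
  refine IsSeqClosed.isClosed fun u x hu hux => ?_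
  have hu' : ∀ n, Fits (((u n).1.1 : LocalConfig E3) : Set E3) (u n).2 := hu
  have hS : Tendsto (fun n => ((u n).1.1 : LocalConfig E3)) atTop (𝓝 (x.1.1 : LocalConfig E3)) :=
    ((continuous_subtype_val.comp continuous_fst).tendsto x).comp hux
  have he : Tendsto (fun n => (u n).2) atTop (𝓝 x.2) := (continuous_snd.tendsto x).comp hux
  have hmatch := LocalConfig.tendsto_iff_locallyMatches.1 hS
  refine (fits_iff _ _).2 ⟨isCompact_setOf_isNormalData.isClosed.mem_of_tendsto he
    (Eventually.of_forall fun n => (hu' n).1), Subset.antisymm ?_ fun q hq => ?_⟩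
  · -- `dataSet x.2 ⊆ ↑S`
    rintro _ ⟨m, i, j, rfl⟩
    set P : LData → E3 := fun e => e.1 (((i : ℝ) • triangularVec₁ e.2.1) +
      ((j : ℝ) • triangularVec₂ e.2.1) + ((haggLabel e.2.2.1 m : ℝ) • barlowOffset e.2.1) +
      (e.2.2.2 m • layerNormal 1))
    have hPt : Tendsto (fun n => P (u n).2) atTop (𝓝 (P x.2)) :=
      ((continuous_point m i j).tendsto x.2).comp he
    change P x.2 ∈ ((x.1.1 : LocalConfig E3) : Set E3)
    refine (LocalConfig.RootedHardCoreConfig.isClosed_coe hδ.out x.1).closure_subset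
      (Metric.mem_closure_iff.2 fun ε hε => ?_)
    obtain ⟨n, hn1, hn2⟩ := (((Metric.tendsto_nhds.1 hPt) (ε / 2) (half_pos hε)).and
      (hmatch (‖P x.2‖ + ε) (ε / 2) (half_pos hε))).exists
    have hmem : P (u n).2 ∈ (((u n).1.1 : LocalConfig E3) : Set E3) := by
      rw [← (hu' n).2]; exact ⟨m, i, j, rfl⟩
    have hnorm : ‖P (u n).2‖ ≤ ‖P x.2‖ + ε := by
      have h1 := norm_sub_norm_le (P (u n).2) (P x.2)
      rw [← dist_eq_norm] at h1
      linarith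
    obtain ⟨b, hb, hbd⟩ := hn2.1 _ hmem hnorm
    refine ⟨b, hb, ?_⟩
    calc dist (P x.2) b ≤ dist (P x.2) (P (u n).2) + dist (P (u n).2) b := dist_triangle _ _ _
      _ < ε / 2 + ε / 2 := by
          refine add_lt_add_of_lt_of_le (by rwa [dist_comm]) ?_
          rw [dist_comm]; exact hbd
      _ = ε := by ring
  · -- `↑S ⊆ dataSet x.2`
    by_contra hq'
    obtain ⟨N, hN⟩ := exists_nat_ge (‖q‖ + 1)
    set I : Finset ℤ := Finset.Icc (-((4 * N + 3 : ℕ) : ℤ)) ((4 * N + 3 : ℕ) : ℤ)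
    set P : ℤ → ℤ → ℤ → LData → E3 := fun m i j e => e.1 (((i : ℝ) • triangularVec₁ e.2.1) +
      ((j : ℝ) • triangularVec₂ e.2.1) + ((haggLabel e.2.2.1 m : ℝ) • barlowOffset e.2.1) +
      (e.2.2.2 m • layerNormal 1))
    have hpos : ∀ m i j : ℤ, 0 < dist q (P m i j x.2) := fun m i j =>
      dist_pos.2 fun h => hq' ⟨m, i, j, h⟩
    have hev0 : ∀ᶠ ε in 𝓝 (0 : ℝ), ∀ m ∈ I, ∀ i ∈ I, ∀ j ∈ I, 2 * ε < dist q (P m i j x.2) :=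
      (eventually_all_finset I).2 fun m _ => (eventually_all_finset I).2 fun i _ =>
        (eventually_all_finset I).2 fun j _ =>
          ((continuous_const.mul continuous_id).tendsto' (0 : ℝ) 0 (by simp)).eventually
            (eventually_lt_nhds (hpos m i j))
    obtain ⟨ε, hε, hε0, hε1⟩ := ((hev0.filter_mono nhdsWithin_le_nhds).and
      (Ioo_mem_nhdsGT (show (0 : ℝ) < 1 / 2 by norm_num))).exists
    have hevA : ∀ᶠ n in atTop, ∀ m ∈ I, ∀ i ∈ I, ∀ j ∈ I, ε < dist q (P m i j (u n).2) :=
      (eventually_all_finset I).2 fun m hm => (eventually_all_finset I).2 fun i hi =>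
        (eventually_all_finset I).2 fun j hj =>
          (tendsto_const_nhds.dist (((continuous_point m i j).tendsto x.2).comp he)
            ).eventually_const_lt (by linarith [hε m hm i hi j hj])
    obtain ⟨n, hnA, hnB⟩ := (hevA.and (hmatch N ε hε0)).exists
    obtain ⟨p, hp, hqp⟩ := hnB.2 q hq (by linarith)
    rw [← (hu' n).2] at hp
    obtain ⟨m, i, j, rfl⟩ := hp
    have hnorm : ‖P m i j (u n).2‖ ≤ N := by
      have h1 := norm_sub_norm_le (P m i j (u n).2) q
      rw [← dist_eq_norm, dist_comm] at h1
      linarith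
    obtain ⟨hm, hi, hj⟩ := index_le (hu' n).1.2.1 (hu' n).1.2.2 (hu' n).1.1 hnorm
    have := hnA m (Finset.mem_Icc.2 (abs_le.1 hm)) i (Finset.mem_Icc.2 (abs_le.1 hi)) j
      (Finset.mem_Icc.2 (abs_le.1 hj))
    exact absurd hqp (not_le.2 this)

/-! ## Sub-goal (2): `S ↦ dataSup φ ↑S` is Borel -/

/-- The data fitting a fixed configuration form a compact set (a closed subset of the compact
normal data, by `lms_isClosed_fits`). [folklore] -/
theorem isCompact_setOf_fits {δ : ℝ} [Fact (0 < δ)] (S : LocalConfig.RootedHardCoreConfig E3 δ) :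
    IsCompact {e : LData | Fits ((S.1 : LocalConfig E3) : Set E3) e} :=
  isCompact_setOf_isNormalData.of_isClosed_subset
    ((lms_isClosed_fits δ).preimage (continuous_const.prodMk continuous_id)) fun _ he => he.1

/-- For a continuous data functional and a configuration fitted by some data, the supremum
`dataSup φ ↑S` is attained on the (compact, nonempty) fitting set. [folklore] -/
theorem exists_fits_eq_dataSup {δ : ℝ} [Fact (0 < δ)] {φ : LData → ℝ} (hφ : Continuous φ)
    (S : LocalConfig.RootedHardCoreConfig E3 δ) {e₀ : LData}
    (he₀ : Fits ((S.1 : LocalConfig E3) : Set E3) e₀) :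
    ∃ e, Fits ((S.1 : LocalConfig E3) : Set E3) e ∧
      φ e = dataSup φ ((S.1 : LocalConfig E3) : Set E3) := by
  obtain ⟨e, he, hee⟩ := ((isCompact_setOf_fits S).image hφ).sSup_mem ⟨φ e₀, e₀, he₀, rfl⟩
  exact ⟨e, he, hee⟩

/-- The projection to the configuration space of a closed subset of the fitting relation is
closed (the relation lives over the compact normal data, and the configuration space is compact
Hausdorff). [folklore] -/
theorem isClosed_image_fst_of_subset_fits {δ : ℝ} [Fact (0 < δ)]
    {F : Set (LocalConfig.RootedHardCoreConfig E3 δ × LData)} (hF : IsClosed F)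
    (hsub : F ⊆ {x | Fits ((x.1.1 : LocalConfig E3) : Set E3) x.2}) :
    IsClosed (Prod.fst '' F) :=
  (((isCompact_univ.prod isCompact_setOf_isNormalData).of_isClosed_subset hF
    fun _ hx => ⟨mem_univ _, (hsub hx).1⟩).image continuous_fst).isClosed

/-- **Sub-goal `lms_measurable_dataSup`.** For a continuous data functional `φ`, the
configuration functional `S ↦ dataSup φ ↑S` is Borel on the compact metric space of rooted
`δ`-hard-core configurations: its super-level set `{c ≤ dataSup}` is the projection of the closed
set `{fits} ∩ {c ≤ φ}` (the supremum over the compact fitting set is attained), united with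
`{no data fit} ∩ {c ≤ 0}`; projections along the compact data factor are closed. [folklore] -/
theorem lms_measurable_dataSup : ∀ (δ : ℝ) [Fact (0 < δ)] (φ : LData → ℝ), Continuous φ → Measurable (fun S : LocalConfig.RootedHardCoreConfig E3 δ => dataSup φ ((S.1 : LocalConfig E3) : Set E3)) := by
  intro δ hδ φ hφ
  have hF := lms_isClosed_fits δ
  have hPc : ∀ c : ℝ, IsClosed (Prod.fst '' ({x : LocalConfig.RootedHardCoreConfig E3 δ × LData |
      Fits ((x.1.1 : LocalConfig E3) : Set E3) x.2} ∩ {x | c ≤ φ x.2})) := fun c =>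
    isClosed_image_fst_of_subset_fits
      (hF.inter (isClosed_le continuous_const (hφ.comp continuous_snd))) fun x hx => hx.1
  have hG : IsClosed (Prod.fst '' {x : LocalConfig.RootedHardCoreConfig E3 δ × LData |
      Fits ((x.1.1 : LocalConfig E3) : Set E3) x.2}) :=
    isClosed_image_fst_of_subset_fits hF fun x hx => hx
  refine measurable_of_Ici fun c => ?_
  have key : (fun S : LocalConfig.RootedHardCoreConfig E3 δ =>
      dataSup φ ((S.1 : LocalConfig E3) : Set E3)) ⁻¹' Ici c =
      Prod.fst '' ({x : LocalConfig.RootedHardCoreConfig E3 δ × LData |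
        Fits ((x.1.1 : LocalConfig E3) : Set E3) x.2} ∩ {x | c ≤ φ x.2}) ∪
      ((Prod.fst '' {x : LocalConfig.RootedHardCoreConfig E3 δ × LData |
        Fits ((x.1.1 : LocalConfig E3) : Set E3) x.2})ᶜ ∩ {_S | c ≤ 0}) := by
    ext S
    rw [mem_preimage, mem_Ici, mem_union, mem_inter_iff, mem_compl_iff]
    have hPiff : S ∈ Prod.fst '' ({x : LocalConfig.RootedHardCoreConfig E3 δ × LData |
        Fits ((x.1.1 : LocalConfig E3) : Set E3) x.2} ∩ {x | c ≤ φ x.2}) ↔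
        ∃ e, Fits ((S.1 : LocalConfig E3) : Set E3) e ∧ c ≤ φ e := by
      constructor
      · rintro ⟨⟨S', e⟩, ⟨h1, h2⟩, rfl⟩
        exact ⟨e, h1, h2⟩
      · rintro ⟨e, h1, h2⟩
        exact ⟨(S, e), ⟨h1, h2⟩, rfl⟩
    have hGiff : S ∈ Prod.fst '' {x : LocalConfig.RootedHardCoreConfig E3 δ × LData |
        Fits ((x.1.1 : LocalConfig E3) : Set E3) x.2} ↔
        ∃ e, Fits ((S.1 : LocalConfig E3) : Set E3) e := by
      constructor
      · rintro ⟨⟨S', e⟩, h1, rfl⟩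
        exact ⟨e, h1⟩
      · rintro ⟨e, h1⟩
        exact ⟨(S, e), h1, rfl⟩
    rw [hPiff, hGiff, mem_setOf_eq]
    rcases ({e : LData | Fits ((S.1 : LocalConfig E3) : Set E3) e}).eq_empty_or_nonempty with
      h0 | ⟨e₀, he₀⟩
    · rw [dataSup_of_isEmpty h0]
      have hno : ¬ ∃ e, Fits ((S.1 : LocalConfig E3) : Set E3) e := by
        rintro ⟨e, he⟩
        have : e ∈ ({e : LData | Fits ((S.1 : LocalConfig E3) : Set E3) e}) := he
        rw [h0] at this
        exact this
      constructor
      · exact fun hc => Or.inr ⟨hno, hc⟩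
      · rintro (⟨e, he, -⟩ | ⟨-, hc⟩)
        · exact absurd ⟨e, he⟩ hno
        · exact hc
    · obtain ⟨e₁, he₁, he₁eq⟩ := exists_fits_eq_dataSup hφ S he₀
      constructor
      · exact fun hc => Or.inl ⟨e₁, he₁, by rwa [he₁eq]⟩
      · rintro (⟨e, he, hce⟩ | ⟨hno, -⟩)
        · exact hce.trans (le_dataSup ((isCompact_setOf_fits S).image hφ).bddAbove he)
        · exact absurd ⟨e₀, he₀⟩ hno
  rw [key]
  exact (hPc c).measurableSet.union (hG.measurableSet.compl.inter (MeasurableSet.const _))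

end Summit.AtomisticToContinuum.Crystallization.Theorems.SlackRigidityPricedFloorsMeasurability

end
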